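import Literature.Analysis.ODE.LinearComparison
import Mathlib.Analysis.Calculus.Deriv.Inv
import Mathlib.Analysis.SpecialFunctions.ExpDeriv
import HarnessLib

/-!
# Tao's cascade ODE, §6.7 "dynamics at the zero scale", IV: equipartition `∫(a₀²-d₀²)` and the lower fence for `a₁`

T. Tao, *Finite time blowup for an averaged three-dimensional Navier–Stokes equation*,
J. Amer. Math. Soc. **29** (2016), 601–674 = arXiv:1402.0290v3, §6.7 (equation numbers of arXiv v3),
the proof of (6.187) `a₁(t_c + 1/K) ≥ 0.1` by contradiction and its consequence (6.188)
`a₁(t) ≥ 0.05`: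

* "(6.189): by repeating the derivation of (6.184) we have `∂ₜ(a₀d₀ ε²/c₀) = -(a₀²-d₀²) + O(K^{-100})`
  on `I`, and hence by the fundamental theorem of calculus and (6.166) `∫ (a₀²-d₀²) = O(K^{-100})`"
  — here `abs_integral_sq_sub_sq_le`: from the `a₀`- and `d₀`-equations (6.179)/(6.132),
  `a₀² - d₀² = ∂ₜ(a₀d₀/(ρc₀)) + a₀d₀∂ₜc₀/(ρc₀²) + (κa₀d₀a₁ - e₁d₀ - a₀e₄)/(ρc₀)`, integrated exactly
  (same device as `TaoCascadeRotorAveraging.lean`), with all constants explicit (with the rotation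
  signs as printed the leading term carries `+`);
* "(6.188): by Gronwall's inequality we will have `a₁(t) ≥ 0.05`" from (6.186)
  `∂ₜa₁ ≥ O(K⁻¹|a₁|) + O(K^{-20})` — here `lower_fence_of_abs_rate`: if `g' ≥ -ν|g| - η` and
  `g(a) ≥ φ₀ > η e^{ν(b-a)} (b-a)` then `g(t) ≥ (φ₀ - η e^{ν(b-a)}(t-a)) e^{-ν(t-a)}` on `[a, b]`
  (Mathlib's fencing theorem `image_le_of_deriv_right_lt_deriv_boundary'`).

Stand-alone real-variable statements in the conventions of `Literature/Analysis/ODE/LinearComparison.lean`.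

## References

* T. Tao, J. Amer. Math. Soc. 29 (2016), 601–674, arXiv:1402.0290v3, §6.7 (6.183)–(6.190).
  [`Tao2016AveragedNS`]
-/

noncomputable section

open Set MeasureTheory intervalIntegral Filter Topology

namespace Literature.Analysis.FluidPDE

namespace TaoCascade

open Literature.Analysis.ODE

/-! ## Equipartition: the integral of `a₀² - d₀²` over a fast-rotation interval -/

/-- **(6.189): `∫ₛᵗ (a₀² - d₀²)` is small when the rotor is fast.** Let `a₀, d₀, c₀` be `C¹` on
`[τ₀, +∞)` and `a₁` arbitrary, `τ₀ ≤ s ≤ t`, with `c₀ ≥ c_min > 0`, `|∂ₜc₀| ≤ L c₀`,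
`|a₀|, |d₀|, |a₁| ≤ M` on `[s, t]`, the `a₀`-equation `|∂ₜa₀ + ρ c₀ d₀| ≤ η₁` and the `d₀`-equation
`|∂ₜd₀ - (ρ c₀ a₀ - κ d₀ a₁)| ≤ η₂`, `ρ > 0`. Then
`|∫ₛᵗ (a₀² - d₀²)| ≤ (2M² + (M²L + |κ|M³ + (η₁+η₂)M)(t-s)) / (ρ c_min)`.
[cite: Tao2016AveragedNS, §6.7 (6.183), (6.189)] -/
theorem abs_integral_sq_sub_sq_le {τ₀ s t : ℝ} {a₀ d₀ c₀ a₁ : ℝ → ℝ} {ρ κ η₁ η₂ L M c_min : ℝ}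
    (ha₀ : ContDiffOn ℝ 1 a₀ (Ici τ₀)) (hd₀ : ContDiffOn ℝ 1 d₀ (Ici τ₀))
    (hc₀ : ContDiffOn ℝ 1 c₀ (Ici τ₀)) (hτ : τ₀ ≤ s) (hst : s ≤ t)
    (hρ : 0 < ρ) (hcmin : 0 < c_min) (hc : ∀ u ∈ Icc s t, c_min ≤ c₀ u)
    (hc' : ∀ u ∈ Icc s t, |derivWithin c₀ (Ici τ₀) u| ≤ L * c₀ u)
    (haM : ∀ u ∈ Icc s t, |a₀ u| ≤ M) (hdM : ∀ u ∈ Icc s t, |d₀ u| ≤ M)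
    (h₁M : ∀ u ∈ Icc s t, |a₁ u| ≤ M)
    (hA : ∀ u ∈ Icc s t, |derivWithin a₀ (Ici τ₀) u + ρ * c₀ u * d₀ u| ≤ η₁)
    (hD : ∀ u ∈ Icc s t,
      |derivWithin d₀ (Ici τ₀) u - (ρ * c₀ u * a₀ u - κ * d₀ u * a₁ u)| ≤ η₂) :
    |∫ u in s..t, (a₀ u ^ 2 - d₀ u ^ 2)| ≤
      (2 * M ^ 2 + (M ^ 2 * L + |κ| * M ^ 3 + (η₁ + η₂) * M) * (t - s)) / (ρ * c_min) := by
  have hM0 : 0 ≤ M := (abs_nonneg _).trans (hdM s ⟨le_rfl, hst⟩)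
  have hη₁ : 0 ≤ η₁ := (abs_nonneg _).trans (hA s ⟨le_rfl, hst⟩)
  have hη₂ : 0 ≤ η₂ := (abs_nonneg _).trans (hD s ⟨le_rfl, hst⟩)
  have hcpos : ∀ u ∈ Icc s t, 0 < c₀ u := fun u hu => hcmin.trans_le (hc u hu)
  have hL : 0 ≤ L := by
    have h1 : 0 ≤ L * c₀ s := (abs_nonneg _).trans (hc' s ⟨le_rfl, hst⟩)
    exact nonneg_of_mul_nonneg_left h1 (hcpos s ⟨le_rfl, hst⟩)
  have hL0 : 0 ≤ M ^ 2 * L + |κ| * M ^ 3 + (η₁ + η₂) * M := by positivity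
  -- the weight `g = a₀ d₀ / (ρ c₀)` and its derivative
  set a₀' : ℝ → ℝ := derivWithin a₀ (Ici τ₀) with ha₀'
  set d₀' : ℝ → ℝ := derivWithin d₀ (Ici τ₀) with hd₀'
  set c₀' : ℝ → ℝ := derivWithin c₀ (Ici τ₀) with hc₀'
  set g : ℝ → ℝ := fun u => a₀ u * d₀ u / (ρ * c₀ u) with hg
  set g' : ℝ → ℝ := fun u =>
    ((a₀' u * d₀ u + a₀ u * d₀' u) * (ρ * c₀ u) - a₀ u * d₀ u * (ρ * c₀' u)) / (ρ * c₀ u) ^ 2 with hg'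
  have ha₀c : ContinuousOn a₀ (Icc s t) := continuousOn_Icc_of_contDiffOn ha₀ hτ
  have hd₀c : ContinuousOn d₀ (Icc s t) := continuousOn_Icc_of_contDiffOn hd₀ hτ
  have hc₀c : ContinuousOn c₀ (Icc s t) := continuousOn_Icc_of_contDiffOn hc₀ hτ
  have ha₀'c : ContinuousOn a₀' (Icc s t) := continuousOn_derivWithin_Icc_of_contDiffOn ha₀ hτ
  have hd₀'c : ContinuousOn d₀' (Icc s t) := continuousOn_derivWithin_Icc_of_contDiffOn hd₀ hτ
  have hc₀'c : ContinuousOn c₀' (Icc s t) := continuousOn_derivWithin_Icc_of_contDiffOn hc₀ hτ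
  have hρc : ∀ u ∈ Icc s t, ρ * c₀ u ≠ 0 := fun u hu => (mul_pos hρ (hcpos u hu)).ne'
  have hgc : ContinuousOn g (Icc s t) := (ha₀c.mul hd₀c).div (continuousOn_const.mul hc₀c) hρc
  have hgd : ∀ u ∈ Ico s t, HasDerivWithinAt g (g' u) (Ici u) u := by
    intro u hu
    have hu' : u ∈ Icc s t := Ico_subset_Icc_self hu
    have h0 := hasDerivWithinAt_Ici_of_contDiffOn ha₀ (hτ.trans hu.1)
    have h3 := hasDerivWithinAt_Ici_of_contDiffOn hd₀ (hτ.trans hu.1)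
    have h2 := (hasDerivWithinAt_Ici_of_contDiffOn hc₀ (hτ.trans hu.1)).const_mul ρ
    exact (h0.fun_mul h3).fun_div h2 (hρc u hu')
  have hg'c : ContinuousOn g' (Icc s t) :=
    (((ha₀'c.mul hd₀c).add (ha₀c.mul hd₀'c)).mul (continuousOn_const.mul hc₀c) |>.sub
      ((ha₀c.mul hd₀c).mul (continuousOn_const.mul hc₀'c))).div
      ((continuousOn_const.mul hc₀c).pow 2) fun u hu => pow_ne_zero 2 (hρc u hu)
  -- FTC for `g`
  have hFTC : ∫ u in s..t, g' u = g t - g s := by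
    apply integral_eq_sub_of_hasDeriv_right_of_le hst hgc
    · intro u hu
      exact (hgd u ⟨hu.1.le, hu.2⟩).mono Ioi_subset_Ici_self
    · exact hg'c.intervalIntegrable_of_Icc hst
  -- the pointwise decomposition `a₀² - d₀² = g' + R`
  have hR : ∀ u ∈ Icc s t, |(a₀ u ^ 2 - d₀ u ^ 2) - g' u| ≤
      (M ^ 2 * L + |κ| * M ^ 3 + (η₁ + η₂) * M) / (ρ * c_min) := by
    intro u hu
    have hcu := hcpos u hu
    have hρcu : 0 < ρ * c₀ u := mul_pos hρ hcu
    set e₁ := a₀' u + ρ * c₀ u * d₀ u with he₁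
    set e₄ := d₀' u - (ρ * c₀ u * a₀ u - κ * d₀ u * a₁ u) with he₄
    have key : (a₀ u ^ 2 - d₀ u ^ 2) - g' u =
        (a₀ u * d₀ u * c₀' u / c₀ u + (κ * a₀ u * d₀ u * a₁ u - (e₁ * d₀ u + a₀ u * e₄))) /
          (ρ * c₀ u) := by
      simp only [hg', he₁, he₄]
      field_simp
      ring
    rw [key, abs_div, abs_of_pos hρcu, div_le_div_iff₀ hρcu (mul_pos hρ hcmin)]
    have ha := haM u hu; have hd := hdM u hu; have h₁ := h₁M u hu
    have hAD : |a₀ u| * |d₀ u| ≤ M ^ 2 := by nlinarith [abs_nonneg (a₀ u), abs_nonneg (d₀ u)]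
    have t1 : |a₀ u * d₀ u * c₀' u / c₀ u| ≤ M ^ 2 * L := by
      rw [abs_div, abs_mul, abs_mul, abs_of_pos hcu, div_le_iff₀ hcu]
      calc |a₀ u| * |d₀ u| * |c₀' u| ≤ M ^ 2 * (L * c₀ u) :=
            mul_le_mul hAD (hc' u hu) (abs_nonneg _) (by positivity)
        _ = M ^ 2 * L * c₀ u := by ring
    have t2 : |κ * a₀ u * d₀ u * a₁ u| ≤ |κ| * M ^ 3 := by
      rw [abs_mul, abs_mul, abs_mul]
      calc |κ| * |a₀ u| * |d₀ u| * |a₁ u| = |κ| * (|a₀ u| * |d₀ u|) * |a₁ u| := by ring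
        _ ≤ |κ| * M ^ 2 * M := by gcongr
        _ = |κ| * M ^ 3 := by ring
    have t3 : |e₁ * d₀ u + a₀ u * e₄| ≤ (η₁ + η₂) * M := by
      calc |e₁ * d₀ u + a₀ u * e₄| ≤ |e₁ * d₀ u| + |a₀ u * e₄| := abs_add_le _ _
        _ = |e₁| * |d₀ u| + |a₀ u| * |e₄| := by rw [abs_mul, abs_mul]
        _ ≤ η₁ * M + M * η₂ :=
            add_le_add (mul_le_mul (hA u hu) hd (abs_nonneg _) hη₁)
              (mul_le_mul ha (hD u hu) (abs_nonneg _) hM0)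
        _ = (η₁ + η₂) * M := by ring
    have hsum : |a₀ u * d₀ u * c₀' u / c₀ u + (κ * a₀ u * d₀ u * a₁ u - (e₁ * d₀ u + a₀ u * e₄))| ≤
        M ^ 2 * L + |κ| * M ^ 3 + (η₁ + η₂) * M := by
      refine (abs_add_le _ _).trans ?_
      have := abs_sub (κ * a₀ u * d₀ u * a₁ u) (e₁ * d₀ u + a₀ u * e₄)
      linarith
    calc |a₀ u * d₀ u * c₀' u / c₀ u + (κ * a₀ u * d₀ u * a₁ u - (e₁ * d₀ u + a₀ u * e₄))| *
          (ρ * c_min)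
        ≤ (M ^ 2 * L + |κ| * M ^ 3 + (η₁ + η₂) * M) * (ρ * c_min) :=
          mul_le_mul_of_nonneg_right hsum (mul_pos hρ hcmin).le
      _ ≤ (M ^ 2 * L + |κ| * M ^ 3 + (η₁ + η₂) * M) * (ρ * c₀ u) := by
          apply mul_le_mul_of_nonneg_left _ hL0
          exact mul_le_mul_of_nonneg_left (hc u hu) hρ.le
  -- bound on `g`
  have hgM : ∀ u ∈ Icc s t, |g u| ≤ M ^ 2 / (ρ * c_min) := by
    intro u hu
    have hρcu : 0 < ρ * c₀ u := mul_pos hρ (hcpos u hu)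
    have hAD : |a₀ u| * |d₀ u| ≤ M ^ 2 := by
      nlinarith [abs_nonneg (a₀ u), abs_nonneg (d₀ u), haM u hu, hdM u hu]
    simp only [hg]
    rw [abs_div, abs_mul, abs_of_pos hρcu, div_le_div_iff₀ hρcu (mul_pos hρ hcmin)]
    calc |a₀ u| * |d₀ u| * (ρ * c_min) ≤ M ^ 2 * (ρ * c_min) :=
          mul_le_mul_of_nonneg_right hAD (mul_pos hρ hcmin).le
      _ ≤ M ^ 2 * (ρ * c₀ u) := by
          apply mul_le_mul_of_nonneg_left _ (by positivity)
          exact mul_le_mul_of_nonneg_left (hc u hu) hρ.le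
  -- assemble
  have hfi : IntervalIntegrable (fun u => a₀ u ^ 2 - d₀ u ^ 2) volume s t :=
    ((ha₀c.pow 2).sub (hd₀c.pow 2)).intervalIntegrable_of_Icc hst
  have hg'i : IntervalIntegrable g' volume s t := hg'c.intervalIntegrable_of_Icc hst
  have hsplit : ∫ u in s..t, (a₀ u ^ 2 - d₀ u ^ 2) =
      (∫ u in s..t, g' u) + ∫ u in s..t, ((a₀ u ^ 2 - d₀ u ^ 2) - g' u) := by
    rw [← integral_add hg'i (hfi.sub hg'i)]
    congr 1; ext u; ring
  have hRint : |∫ u in s..t, ((a₀ u ^ 2 - d₀ u ^ 2) - g' u)| ≤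
      (M ^ 2 * L + |κ| * M ^ 3 + (η₁ + η₂) * M) / (ρ * c_min) * (t - s) := by
    have h := norm_integral_le_of_norm_le_const (a := s) (b := t)
      (f := fun u => (a₀ u ^ 2 - d₀ u ^ 2) - g' u)
      (C := (M ^ 2 * L + |κ| * M ^ 3 + (η₁ + η₂) * M) / (ρ * c_min)) ?_
    · rw [abs_of_nonneg (sub_nonneg.2 hst)] at h
      simpa [Real.norm_eq_abs] using h
    · intro u hu
      rw [uIoc_of_le hst] at hu
      rw [Real.norm_eq_abs]
      exact hR u ⟨hu.1.le, hu.2⟩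
  rw [hsplit, hFTC]
  calc |g t - g s + ∫ u in s..t, ((a₀ u ^ 2 - d₀ u ^ 2) - g' u)|
      ≤ |g t - g s| + |∫ u in s..t, ((a₀ u ^ 2 - d₀ u ^ 2) - g' u)| := abs_add_le _ _
    _ ≤ (|g t| + |g s|) + (M ^ 2 * L + |κ| * M ^ 3 + (η₁ + η₂) * M) / (ρ * c_min) * (t - s) :=
        add_le_add (abs_sub _ _) hRint
    _ ≤ (M ^ 2 / (ρ * c_min) + M ^ 2 / (ρ * c_min)) +
          (M ^ 2 * L + |κ| * M ^ 3 + (η₁ + η₂) * M) / (ρ * c_min) * (t - s) := by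
        gcongr
        · exact hgM t ⟨hst, le_rfl⟩
        · exact hgM s ⟨le_rfl, hst⟩
    _ = (2 * M ^ 2 + (M ^ 2 * L + |κ| * M ^ 3 + (η₁ + η₂) * M) * (t - s)) / (ρ * c_min) := by
        field_simp; ring

/-! ## The lower fence for `a₁` -/

/-- **(6.188): a lower fence for `∂ₜg ≥ -ν|g| - η`.** Let `g` be continuous on `[a, b]` with right
derivative `g'` on `[a, b)`, `ν, η ≥ 0`, `g' ≥ -ν|g| - η` there, and `g(a) ≥ φ₀` with
`φ₀ ≥ η'(b-a)` where `η' > η e^{ν(b-a)}`. Then `g(t) ≥ (φ₀ - η'(t-a)) e^{-ν(t-a)}` on `[a, b]`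
(fencing theorem with the lower fence `φ(t) = (φ₀ - η'(t-a))e^{-ν(t-a)} ≥ 0`, at whose contact
points `g' ≥ -νφ - η > φ'`). [cite: Tao2016AveragedNS, §6.7 (6.186), (6.188)] -/
theorem lower_fence_of_abs_rate {a b : ℝ} {g g' : ℝ → ℝ} {ν η η' φ₀ : ℝ}
    (hg : ContinuousOn g (Icc a b)) (hg' : ∀ t ∈ Ico a b, HasDerivWithinAt g (g' t) (Ici t) t)
    (hν : 0 ≤ ν) (hη : 0 ≤ η) (bound : ∀ t ∈ Ico a b, -ν * |g t| - η ≤ g' t) (hga : φ₀ ≤ g a)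
    (hη' : η * Real.exp (ν * (b - a)) < η') (hφ₀ : η' * (b - a) ≤ φ₀) {t : ℝ} (ht : t ∈ Icc a b) :
    (φ₀ - η' * (t - a)) * Real.exp (-ν * (t - a)) ≤ g t := by
  have hab : a ≤ b := ht.1.trans ht.2
  -- the fence and its derivative
  set φ : ℝ → ℝ := fun u => (φ₀ - η' * (u - a)) * Real.exp (-ν * (u - a)) with hφ
  set φ' : ℝ → ℝ := fun u => -η' * Real.exp (-ν * (u - a)) +
      (φ₀ - η' * (u - a)) * (Real.exp (-ν * (u - a)) * -ν) with hφ'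
  have hφd : ∀ u, HasDerivAt φ (φ' u) u := by
    intro u
    have h1 : HasDerivAt (fun u => φ₀ - η' * (u - a)) (-η') u := by
      simpa using (((hasDerivAt_id u).sub_const a).const_mul η').const_sub φ₀
    have h2 : HasDerivAt (fun u => -ν * (u - a)) (-ν) u := by
      simpa using ((hasDerivAt_id u).sub_const a).const_mul (-ν)
    have := h1.fun_mul h2.exp
    refine this.congr_deriv ?_
    simp only [hφ']
  have hη'0 : 0 < η' := lt_of_le_of_lt (by positivity) hη'
  -- fence nonnegative on `[a, b]`
  have hφnn : ∀ u ∈ Icc a b, 0 ≤ φ₀ - η' * (u - a) := by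
    intro u hu
    have : η' * (u - a) ≤ η' * (b - a) := mul_le_mul_of_nonneg_left (by linarith [hu.2]) hη'0.le
    linarith
  -- apply the fencing theorem to `-g ≤ -φ`
  have key := image_le_of_deriv_right_lt_deriv_boundary' (f := fun u => -g u)
    (f' := fun u => -g' u) (B := fun u => -φ u) (B' := fun u => -φ' u) (a := a) (b := b)
    hg.neg (fun u hu => (hg' u hu).neg) (by simp [hφ]; linarith)
    (fun u _ => (hφd u).continuousAt.continuousWithinAt.neg)
    (fun u _ => (hφd u).hasDerivWithinAt.neg) ?_ ht
  · simp only [neg_le_neg_iff] at key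
    simpa [hφ] using key
  · intro u hu htouch
    have hu' : u ∈ Icc a b := Ico_subset_Icc_self hu
    have hgu : g u = φ u := by simpa using congrArg Neg.neg htouch
    have hb := bound u hu
    have hE : 0 < Real.exp (-ν * (u - a)) := Real.exp_pos _
    have hEab : Real.exp (-ν * (u - a)) * Real.exp (ν * (b - a)) ≥ 1 := by
      rw [← Real.exp_add, ge_iff_le, Real.one_le_exp_iff]
      nlinarith [hu'.1, hu'.2]
    have hφu : 0 ≤ φ u := mul_nonneg (hφnn u hu') hE.le
    have habs : |g u| = φ u := by rw [hgu, abs_of_nonneg hφu]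
    rw [habs] at hb
    -- `φ' < -ν φ - η ≤ g'`
    show -g' u < -φ' u
    have hlt : φ' u < -ν * φ u - η := by
      simp only [hφ', hφ]
      have : η < η' * Real.exp (-ν * (u - a)) := by
        calc η = η * 1 := (mul_one η).symm
          _ ≤ η * (Real.exp (-ν * (u - a)) * Real.exp (ν * (b - a))) :=
              mul_le_mul_of_nonneg_left hEab hη
          _ = (η * Real.exp (ν * (b - a))) * Real.exp (-ν * (u - a)) := by ring
          _ < η' * Real.exp (-ν * (u - a)) := mul_lt_mul_of_pos_right hη' hE
      nlinarith
    linarith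

/-- **(6.188) in closed form.** Under `g' ≥ -ν|g| - η` on `[a, b)` with `ν, η ≥ 0` and
`g(a) ≥ φ₀ > η e^{ν(b-a)} (b-a)`, one has `g(t) ≥ (φ₀ - η e^{ν(b-a)}(t-a)) e^{-ν(t-a)}` on `[a, b]`.
[cite: Tao2016AveragedNS, §6.7 (6.188)] -/
theorem lower_fence_of_abs_rate' {a b : ℝ} {g g' : ℝ → ℝ} {ν η φ₀ : ℝ}
    (hg : ContinuousOn g (Icc a b)) (hg' : ∀ t ∈ Ico a b, HasDerivWithinAt g (g' t) (Ici t) t)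
    (hν : 0 ≤ ν) (hη : 0 ≤ η) (bound : ∀ t ∈ Ico a b, -ν * |g t| - η ≤ g' t) (hga : φ₀ ≤ g a)
    (hφ₀ : η * Real.exp (ν * (b - a)) * (b - a) < φ₀) {t : ℝ} (ht : t ∈ Icc a b) :
    (φ₀ - η * Real.exp (ν * (b - a)) * (t - a)) * Real.exp (-ν * (t - a)) ≤ g t := by
  have hab : a ≤ b := ht.1.trans ht.2
  have hE : 0 < Real.exp (-ν * (t - a)) := Real.exp_pos _
  set η₀ := η * Real.exp (ν * (b - a)) with hη₀
  have hη₀0 : 0 ≤ η₀ := by positivity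
  -- room `ι` between `η₀ (b-a)` and `φ₀`
  refine le_of_forall_pos_lt_add fun ι' hι' => ?_
  rcases eq_or_lt_of_le hab with hab' | hab'
  · -- degenerate interval: `t = a`
    subst hab'
    have hta : t = a := le_antisymm ht.2 ht.1
    subst hta
    simp
    linarith
  · set ι : ℝ := min ((φ₀ - η₀ * (b - a)) / (b - a)) (ι' / ((b - a) * 1)) / 2 with hι
    have hpos1 : 0 < (φ₀ - η₀ * (b - a)) / (b - a) := div_pos (by linarith) (by linarith)
    have hpos2 : 0 < ι' / ((b - a) * 1) := div_pos hι' (by nlinarith)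
    have hιpos : 0 < ι := by rw [hι]; positivity
    have hιle1 : ι ≤ (φ₀ - η₀ * (b - a)) / (b - a) / 2 := by
      rw [hι]; gcongr; exact min_le_left _ _
    have hιle2 : ι ≤ ι' / ((b - a) * 1) / 2 := by
      rw [hι]; gcongr; exact min_le_right _ _
    have h1 : (η₀ + ι) * (b - a) ≤ φ₀ := by
      have : ι * (b - a) ≤ (φ₀ - η₀ * (b - a)) / 2 := by
        have := mul_le_mul_of_nonneg_right hιle1 (by linarith : 0 ≤ b - a)
        calc ι * (b - a) ≤ (φ₀ - η₀ * (b - a)) / (b - a) / 2 * (b - a) := this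
          _ = (φ₀ - η₀ * (b - a)) / 2 := by field_simp
      nlinarith
    have key := lower_fence_of_abs_rate hg hg' hν hη bound hga (η' := η₀ + ι)
      (by rw [hη₀]; linarith) h1 ht
    have h2 : ι * (t - a) * Real.exp (-ν * (t - a)) < ι' := by
      have hE1 : Real.exp (-ν * (t - a)) ≤ 1 := by
        rw [Real.exp_le_one_iff]; nlinarith [ht.1]
      have hta : t - a ≤ b - a := by linarith [ht.2]
      have : ι * (t - a) ≤ ι' / 2 := by
        calc ι * (t - a) ≤ ι' / ((b - a) * 1) / 2 * (b - a) := by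
              apply mul_le_mul hιle2 hta (by linarith [ht.1]) (by positivity)
          _ = ι' / 2 := by field_simp
      calc ι * (t - a) * Real.exp (-ν * (t - a)) ≤ ι' / 2 * 1 := by
            apply mul_le_mul this hE1 hE.le (by positivity)
        _ < ι' := by linarith
    calc (φ₀ - η₀ * (t - a)) * Real.exp (-ν * (t - a))
        = (φ₀ - (η₀ + ι) * (t - a)) * Real.exp (-ν * (t - a)) +
            ι * (t - a) * Real.exp (-ν * (t - a)) := by ring
      _ < g t + ι' := add_lt_add_of_le_of_lt key h2

end TaoCascade

end Literature.Analysis.FluidPDE
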